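import Mathlib
import Summits.KontsevichZagierPeriods.Zeta5Search.Families.CubicalChartFiveSpans
import Summits.KontsevichZagierPeriods.Zeta5Search.Families.SeatingGapGrowth
import Summits.KontsevichZagierPeriods.Zeta5Search.Families.CellularEightGrowthConstantsC
import Summits.KontsevichZagierPeriods.Zeta5Search.Families.BasicGrowthClasses
import Summits.KontsevichZagierPeriods.Zeta5Search.Families.ExactDualityBZ
import Summits.KontsevichZagierPeriods.Zeta5Search.Families.CubicalChartLeadPi8v
import Summits.KontsevichZagierPeriods.Zeta5Search.Brown8.LeadingCoefficientsA
import HarnessLib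

/-!
# ζ(5) search — fam-brown8's census leading coefficients `lead_pi8v` (class ₈π₈^∨) ARE gap constant terms; growth exponents

HONEST FRAMING: systematic search; no irrationality claim unless certified.  Cell `pub-zeta5`, certifier 2 (cert-2 g11,
2026-08-22).  Identities between integers (binomial sums / polynomial coefficients) and the elementary real analysis of
`Families/SeatingGapGrowth`; nothing about the arithmetic of `ζ(5)`; no number of record moves; no conjecture node is
used (for THIS class the census recurrence `Brown8.LeadRec_pi8v` is already a theorem, cert-2 g10's
`CubicalChart.leadRec_pi8v_holds`, and is not used here).  Statements about the SIZE of the integers `lead_pi8v n = Q_n`;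
the arithmetic of the `₈π₈^∨` forms is [BrownZudilin2022]'s and is not touched; nothing here bears on irrationality.

METHOD (same for every class; dictionary `Families/CubicalChartFiveSpans`, engine `CubicalChartN.coeff_chart` of cert-2 g10,
rate theorem `Families/SeatingGapGrowth.tendsto_log_gapCT_div`).  The census sum `lead_<class> n` of
`Brown8/LeadingCoefficientsA,B` is read off the cubical chart `z_{η₁}=0, z_{η_{k+1}} = x_k⋯x₅, z_{η₇}=1, z_{η₈}=∞` of its
frame `η`; in P2's simplicial convention (`Families/CellularIntegral`) the frame is the SEATING `τ = η⁻¹`, whose six finite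
edges `τδ⁰` span gap intervals; `lead_<class> n = SeatingGap.gapCT τ n = [X^{n·𝟙}] ∏_{finite edges} (Σ_{span} X)^n`
(constant-term invariance: the four binomials of the census formula are the chart images of the four chords not through the
point `z = 0`, its five `coeffPow (−n−1) ·` factors the five gap series), hence `lead ≥ 0`, and
`log lead_<class>(n)/n → −log M_τ` with `M_τ = fSup τ` identified with P2's certified growth constant of the atlas class of `τ`
(`Families/BasicGrowthClasses.fSup_ofSeating_eq_of_equivalent`, `Families/CellularEightGrowthConstants*`).

* CLASS ₈π₈^∨ (`lead_pi8v`, `Brown8/LeadingCoefficientsA`): frame `η = (1, 4, 2, 8, 6, 3, 5, 7)`, seating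
  `τ = (1, 3, 6, 2, 7, 5, 8, 4)` (`tau8v`, 0-based `(0, 2, 5, 1, 6, 4, 7, 3)`) ≃ atlas `(8, 2, 5, 1, 6, 4, 7, 3)` = `p8_8` (class ₈π₈);
  finite-edge spans [0,2), [2,5), [1,5), [1,6), [4,6), [0,3); **`lead_pi8v_eq_gapCT`**, `gapCT_tau8v_one : gapCT = 21` at `n = 1`,
  **`tendsto_log_lead_pi8v_div`**: `log lead_pi8v(n)/n → −log fSup p8_8`, growth factor
  `1/M(₈π₈) ∈ (592.0793, 592.0794)` (`tendsto_log_lead_pi8v_div_growth`).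
* **`tendsto_log_Q_div` — THE GROWTH RATE OF BROWN–ZUDILIN'S `Q_n` IS A KERNEL THEOREM**: `τ = tau8v` IS P2's exact-atlas
  seating `sigmaS8h` (`tau8v_eq_sigmaS8h`, `rfl`), whose growth constant is ALGEBRAIC: `fSup sigmaS8h = 1/λ₃`, `λ₃` the largest
  root of Brown–Zudilin's cubic `χ(λ) = 4λ³ − 2368λ² − 188λ + 1` (`Families/ExactDualityBZ.exists_fSup_S8h_eq_inv`, P2); with
  cert-2 g10's `CubicalChart.lead_pi8v_eq_Q` (`lead_pi8v n = Q_n`, Brown–Zudilin's (7)) this gives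
  `log Q_n / n → log λ₃`, `λ₃ ∈ (592.0793805, 592.0793806)`, `χ(λ₃) = 0` — the third conjunct of the Literature named fact
  `BrownZudilin2022.rates` ([BrownZudilin2022, §2]: "`log Q_n/n → log λ₃ = 6.38364071…`"), obtained here NOT from the
  recurrence (Poincaré–Perron) but from the dual cell: coefficient asymptotics of `P₁ⁿ` (cert-2 g9) + the variational
  principle in gap coordinates + P2's exact evaluation of `M_{₈π₈}`.  The other two conjuncts of `rates` (the decay
  `log|Q_nζ(5) − P_n|/n → log|λ₂|` and its `ζ(3)` companion) are statements about the linear forms and are NOT touched.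
Exact cross-check outside the kernel: `HOME/cert-2/g11/code/s1_classes_tau.py` (`lead = gapCT τ` for `n ≤ 6`, every class;
the equivalent atlas plan; `lead(6)/lead(5)` against `1/M`).  Standard axioms only.
-/

noncomputable section

open MvPowerSeries Finset

namespace Summit.KontsevichZagierPeriods.Zeta5Search.Families.Cellular

namespace CubicalChartN

open Summit.KontsevichZagierPeriods.Zeta5Search.Brown8 (coeffPow sumTo lead_pi8v lead_pi8v_values)
open CubicalChart (coeffPow_nat_nat)

/-! # Class ₈π₈^∨: `lead_pi8v` -/

/-! ### The seating `τ = η⁻¹` -/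

/-- The inverse `τ = (1, 3, 6, 2, 7, 5, 8, 4)` of the census frame `η = (1, 4, 2, 8, 6, 3, 5, 7)` of class ₈π₈^∨, 0-based. -/
def tau8v : Fin 8 → Fin 8 := ![0, 2, 5, 1, 6, 4, 7, 3]

/-- `τ` is the printed list `(1, 3, 6, 2, 7, 5, 8, 4)` read 0-based, and is bijective. -/
theorem tau8v_spec : tau8v = ofSeating (ℓ := 5) [1, 3, 6, 2, 7, 5, 8, 4] ∧ Function.Bijective tau8v :=
  ⟨by decide, Finite.injective_iff_bijective.1 (by decide)⟩

/-- `τ` is the inverse of the frame `η = (1, 4, 2, 8, 6, 3, 5, 7)` (0-based `(0, 3, 1, 7, 5, 2, 4, 6)`). -/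
theorem tau8v_inverse : ∀ i, tau8v ((![0, 3, 1, 7, 5, 2, 4, 6] : Fin 8 → Fin 8) i) = i ∧
    (![0, 3, 1, 7, 5, 2, 4, 6] : Fin 8 → Fin 8) (tau8v i) = i := by decide

/-- `τ` is a seating of class ₈π₈: equivalent [Brown2016, Def. 3.1] to the atlas plan `(8, 2, 5, 1, 6, 4, 7, 3)`. -/
theorem tau8v_equiv : Literature.NumberTheory.Irrationality.Brown2016.Equivalent 8 [1, 3, 6, 2, 7, 5, 8, 4]
    [8, 2, 5, 1, 6, 4, 7, 3] := by decide

/-! ### The gap polynomial of `τ`, explicitly -/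

/-- **The gap polynomial of `τ`** (finite edges `{0,2}, {2,5}, {5,1}, {1,6}, {6,4}, {3,0}` of `τδ⁰` spanning [0,2), [2,5), [1,5), [1,6), [4,6), [0,3); the edges `{4,7}, {7,3}` pass
through `∞ = 7`). -/
theorem gapPoly_tau8v (n : ℕ) : SeatingGap.gapPoly tau8v n =
    (MvPolynomial.X 0 + MvPolynomial.X 1) ^ n *
    (MvPolynomial.X 2 + MvPolynomial.X 3 + MvPolynomial.X 4) ^ n *
    (MvPolynomial.X 1 + MvPolynomial.X 2 + MvPolynomial.X 3 + MvPolynomial.X 4) ^ n *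
    (MvPolynomial.X 1 + MvPolynomial.X 2 + MvPolynomial.X 3 + MvPolynomial.X 4 + MvPolynomial.X 5) ^ n *
    (MvPolynomial.X 4 + MvPolynomial.X 5) ^ n *
    (MvPolynomial.X 0 + MvPolynomial.X 1 + MvPolynomial.X 2) ^ n := by
  have t0 : SpanHall.spanPoly (SeatingGap.edgeSpan tau8v) 0 ^ SeatingGap.finExp tau8v n 0 =
      (MvPolynomial.X 0 + MvPolynomial.X 1) ^ n := by
    rw [SpanHall.spanPoly, show SeatingGap.edgeSpan tau8v 0 = (univ.filter fun w : Fin 6 => 0 ≤ w.val ∧ w.val < 2) by decide,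
      sumX_span01, show SeatingGap.finExp tau8v n 0 = n by simp [SeatingGap.finExp, tau8v]]
  have t1 : SpanHall.spanPoly (SeatingGap.edgeSpan tau8v) 1 ^ SeatingGap.finExp tau8v n 1 =
      (MvPolynomial.X 2 + MvPolynomial.X 3 + MvPolynomial.X 4) ^ n := by
    rw [SpanHall.spanPoly, show SeatingGap.edgeSpan tau8v 1 = (univ.filter fun w : Fin 6 => 2 ≤ w.val ∧ w.val < 5) by decide,
      sumX_span24, show SeatingGap.finExp tau8v n 1 = n by simp [SeatingGap.finExp, tau8v]]
  have t2 : SpanHall.spanPoly (SeatingGap.edgeSpan tau8v) 2 ^ SeatingGap.finExp tau8v n 2 =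
      (MvPolynomial.X 1 + MvPolynomial.X 2 + MvPolynomial.X 3 + MvPolynomial.X 4) ^ n := by
    rw [SpanHall.spanPoly, show SeatingGap.edgeSpan tau8v 2 = (univ.filter fun w : Fin 6 => 1 ≤ w.val ∧ w.val < 5) by decide,
      sumX_span14, show SeatingGap.finExp tau8v n 2 = n by simp [SeatingGap.finExp, tau8v]]
  have t3 : SpanHall.spanPoly (SeatingGap.edgeSpan tau8v) 3 ^ SeatingGap.finExp tau8v n 3 =
      (MvPolynomial.X 1 + MvPolynomial.X 2 + MvPolynomial.X 3 + MvPolynomial.X 4 + MvPolynomial.X 5) ^ n := by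
    rw [SpanHall.spanPoly, show SeatingGap.edgeSpan tau8v 3 = (univ.filter fun w : Fin 6 => 1 ≤ w.val ∧ w.val < 6) by decide,
      sumX_span15, show SeatingGap.finExp tau8v n 3 = n by simp [SeatingGap.finExp, tau8v]]
  have t4 : SpanHall.spanPoly (SeatingGap.edgeSpan tau8v) 4 ^ SeatingGap.finExp tau8v n 4 =
      (MvPolynomial.X 4 + MvPolynomial.X 5) ^ n := by
    rw [SpanHall.spanPoly, show SeatingGap.edgeSpan tau8v 4 = (univ.filter fun w : Fin 6 => 4 ≤ w.val ∧ w.val < 6) by decide,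
      sumX_span45, show SeatingGap.finExp tau8v n 4 = n by simp [SeatingGap.finExp, tau8v]]
  have t5 : SpanHall.spanPoly (SeatingGap.edgeSpan tau8v) 5 ^ SeatingGap.finExp tau8v n 5 = 1 := by
    rw [show SeatingGap.finExp tau8v n 5 = 0 by simp [SeatingGap.finExp, tau8v], pow_zero]
  have t6 : SpanHall.spanPoly (SeatingGap.edgeSpan tau8v) 6 ^ SeatingGap.finExp tau8v n 6 = 1 := by
    rw [show SeatingGap.finExp tau8v n 6 = 0 by simp [SeatingGap.finExp, tau8v], pow_zero]
  have t7 : SpanHall.spanPoly (SeatingGap.edgeSpan tau8v) 7 ^ SeatingGap.finExp tau8v n 7 =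
      (MvPolynomial.X 0 + MvPolynomial.X 1 + MvPolynomial.X 2) ^ n := by
    rw [SpanHall.spanPoly, show SeatingGap.edgeSpan tau8v 7 = (univ.filter fun w : Fin 6 => 0 ≤ w.val ∧ w.val < 3) by decide,
      sumX_span02, show SeatingGap.finExp tau8v n 7 = n by simp [SeatingGap.finExp, tau8v]]
  unfold SeatingGap.gapPoly SpanHall.spanProd
  show ∏ i : Fin 8, SpanHall.spanPoly (SeatingGap.edgeSpan tau8v) i ^ SeatingGap.finExp tau8v n i = _
  rw [Fin.prod_univ_eight, t0, t1, t2, t3, t4, t5, t6, t7]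
  ring

/-! ### The chart image of the gap polynomial -/

/-- The prefactor monomial of the chart image, as a product. -/
theorem monomial_c8v (n : ℕ) :
    (monomial (n • tail (1 : Fin 6) + n • tail (2 : Fin 6) + (2 * n) • tail (4 : Fin 6)) (1 : ℤ) : T 5) = (x 1 * x 2 * x 3 * x 4) ^ n * (x 2 * x 3 * x 4) ^ n * x 4 ^ (2 * n) := by
  rw [MvPowerSeries.monomial_one_eq, Finsupp.prod_fintype _ _ (fun i => by simp)]
  simp only [Fin.prod_univ_five, Finsupp.coe_add, Finsupp.coe_smul, Pi.add_apply, Pi.smul_apply, tail_apply,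
    smul_eq_mul]
  simp only [Fin.isValue, Fin.val_zero, Fin.val_one, Fin.val_two, show (4 : Fin 6).val = 4 from rfl, show (3 : Fin 5).val = 3 from rfl, show (4 : Fin 5).val = 4 from rfl]
  norm_num
  ring

/-- **The chart image of the gap polynomial of `τ`**, binomial factors in the census file's summation order
`k₁ ↦ 1−x^(seg 0 3)`, `k₂ ↦ 1−x^(seg 0 4)`, `k₃ ↦ 1−x^(seg 1 3)`, `k₄ ↦ 1−x^(seg 3 4)` (0-based variables). -/
theorem chart_gapPoly_tau8v (n : ℕ) :
    chart (SeatingGap.gapPoly tau8v n) = (monomial (n • tail (1 : Fin 6) + n • tail (2 : Fin 6) + (2 * n) • tail (4 : Fin 6)) 1 : T 5) *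
      ((1 - monomial (seg 0 3) 1) ^ n * ((1 - monomial (seg 0 4) 1) ^ n * ((1 - monomial (seg 1 3) 1) ^ n *
        (1 - monomial (seg 3 4) 1) ^ n))) := by
  rw [gapPoly_tau8v, map_mul, map_mul, map_mul, map_mul, map_mul, map_pow, map_pow, map_pow, map_pow, map_pow, map_pow,
    chart_span01, chart_span24, chart_span14, chart_span15, chart_span45, chart_span02, monomial_c8v,
    monomial_seg03, monomial_seg04, monomial_seg13, monomial_seg34]
  simp only [mul_pow]
  ring

/-! ### The census sum -/

/-- **fam-brown8's census leading coefficient of class ₈π₈^∨ IS the diagonal gap constant term of the seating `τ`**: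
`lead_pi8v n = gapCT tau8v n` for every `n`. -/
theorem lead_pi8v_eq_gapCT (n : ℕ) : lead_pi8v n = SeatingGap.gapCT tau8v n := by
  -- homogeneity: `6n`
  have hdeg : (SeatingGap.gapPoly tau8v n).IsHomogeneous (∑ w : Fin 6, (fun _ : Fin 6 => n) w) := by
    have h := SeatingGap.gapPoly_isHomogeneous tau8v n
    have e : ∑ i, SeatingGap.finExp tau8v n i = ∑ w : Fin 6, (fun _ : Fin 6 => n) w := by
      simp [SeatingGap.finExp, tau8v, Fin.sum_univ_eight]; ring
    rwa [e] at h
  have hct := coeff_chart (SeatingGap.gapPoly tau8v n) (fun _ : Fin 6 => n) hdeg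
  symm
  unfold SeatingGap.gapCT
  rw [SeatingGap.smul_ones, ← hct, ← coeffZ_natCast, chart_gapPoly_tau8v, mul_assoc, coeffZ_monomial_mul]
  simp only [mul_assoc, coeffZ_oneSubPow_mul, coeffZ_U, Finset.mul_sum]
  -- the census side
  unfold lead_pi8v
  simp only [CubicalChart.sumTo_eq_sum]
  refine Finset.sum_congr rfl fun k₁ _ => Finset.sum_congr rfl fun k₂ _ => Finset.sum_congr rfl fun k₃ _ =>
    Finset.sum_congr rfl fun k₄ _ => ?_
  simp only [coeffPow_nat_nat]
  rw [Fin.prod_univ_five]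
  simp only [Mexp_apply6, Fin.sum_univ_six, Finsupp.coe_equivFunOnFinite_symm, Finsupp.coe_add, Finsupp.coe_smul,
    Pi.add_apply, Pi.smul_apply, smul_eq_mul, tail_apply, seg_apply, Fin.isValue]
  simp only [Fin.val_zero, Fin.val_one, Fin.val_two, show (3 : Fin 6).val = 3 from rfl,
    show (4 : Fin 6).val = 4 from rfl, show (5 : Fin 6).val = 5 from rfl, show (3 : Fin 5).val = 3 from rfl,
    show (4 : Fin 5).val = 4 from rfl]
  norm_num
  ring_nf

/-- `lead_pi8v n ≥ 0` (a count of transport tables). -/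
theorem lead_pi8v_nonneg (n : ℕ) : 0 ≤ lead_pi8v n := by
  rw [lead_pi8v_eq_gapCT]; exact SeatingGap.gapCT_nonneg tau8v n

/-- `gapCT τ 1 = 21` (the census value `lead_pi8v 1 = 21`). -/
theorem gapCT_tau8v_one : SeatingGap.gapCT tau8v 1 = 21 := by
  rw [← lead_pi8v_eq_gapCT]
  have h := lead_pi8v_values
  simp only [List.cons.injEq] at h
  exact h.2.1

/-! ### The growth exponent of `lead_pi8v` -/

/-- **`M_τ = M(₈π₈)`**: the growth constant of the seating `τ` is that of the atlas representative `p8_8`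
(class function, `Families/BasicGrowthClasses.fSup_ofSeating_eq_of_equivalent`). -/
theorem fSup_tau8v : fSup tau8v = fSup p8_8 := by
  rw [tau8v_spec.1, p8_8_spec.1]
  exact fSup_ofSeating_eq_of_equivalent (by decide) (by decide) tau8v_equiv

/-- **Growth exponent of the census leading coefficients of class ₈π₈^∨**: `log lead_pi8v(n) / n → −log M(₈π₈)`,
`M(₈π₈) = fSup p8_8` the growth constant of the basic cellular integrals of the seating `τ` (P2,
`Families/CellularEightGrowthConstantsC`): growth of the leading coefficients = reciprocal of the decay of those integrals
(`Families/SeatingGapGrowth`). -/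
theorem tendsto_log_lead_pi8v_div :
    Filter.Tendsto (fun n : ℕ => Real.log (lead_pi8v n : ℝ) / n) Filter.atTop (nhds (-Real.log (fSup p8_8))) := by
  have h := SeatingGap.tendsto_log_gapCT_div tau8v tau8v_spec.2 (by rw [gapCT_tau8v_one]; norm_num)
  rw [fSup_tau8v] at h
  exact h.congr fun n => by rw [lead_pi8v_eq_gapCT]

/-- **The growth factor, certified**: `log lead_pi8v(n)/n → log λ` with `λ = 1/M(₈π₈) ∈ (592.0793, 592.0794)`
(P2's enclosure `fSup_p8_8_mem_Icc`). -/
theorem tendsto_log_lead_pi8v_div_growth : ∃ lam : ℝ, lam = (fSup p8_8)⁻¹ ∧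
    (5920793 : ℝ) / 10000 < lam ∧ lam < (5920794 : ℝ) / 10000 ∧
    Filter.Tendsto (fun n : ℕ => Real.log (lead_pi8v n : ℝ) / n) Filter.atTop (nhds (Real.log lam)) := by
  have hpos : 0 < fSup p8_8 := fSup_pos p8_8 (Finite.injective_iff_bijective.1 p8_8_spec.2.1)
  obtain ⟨hlo, hhi⟩ := fSup_p8_8_mem_Icc
  refine ⟨(fSup p8_8)⁻¹, rfl, ?_, ?_, ?_⟩
  · rw [lt_inv_comm₀ (by norm_num) hpos]
    exact lt_of_le_of_lt hhi (by norm_num)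
  · rw [inv_lt_comm₀ hpos (by norm_num)]
    exact lt_of_lt_of_le (by norm_num) hlo
  · rw [Real.log_inv]
    exact tendsto_log_lead_pi8v_div


/-! ## Brown–Zudilin's `Q_n`: the growth rate `log Q_n / n → log λ₃` -/

/-- `τ = tau8v` is literally P2's exact-atlas seating `sigmaS8h = (0,2,5,1,6,4,7,3)` (`Families/ExactS8hSinkhorn`). -/
theorem tau8v_eq_sigmaS8h : tau8v = sigmaS8h := rfl

/-- **`log Q_n / n → log λ₃`** for Brown–Zudilin's totally symmetric leading coefficients `Q_n` ((7) of [BrownZudilin2022]):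
`λ₃ ∈ (592.0793805, 592.0793806)` the largest root of `χ(λ) = 4λ³ − 2368λ² − 188λ + 1` — the `Q`-conjunct of the named fact
`BrownZudilin2022.rates`, PROVED (dual-cell route: `Q_n = lead_pi8v n = gapCT sigmaS8h n`, growth `= 1/M_{₈π₈} = λ₃`). -/
theorem tendsto_log_Q_div : ∃ lam : ℝ,
    lam ∈ Set.Ioo ((5920793805 : ℝ) / 10 ^ 7) ((5920793806 : ℝ) / 10 ^ 7) ∧
    Literature.NumberTheory.Irrationality.BrownZudilin2022.charPoly lam = 0 ∧
    Filter.Tendsto (fun n : ℕ => Real.log (Literature.NumberTheory.Irrationality.BrownZudilin2022.Q n : ℝ) / n)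
      Filter.atTop (nhds (Real.log lam)) := by
  obtain ⟨lam, hmem, hχ, hM⟩ := exists_fSup_S8h_eq_inv
  refine ⟨lam, hmem, hχ, ?_⟩
  have h := SeatingGap.tendsto_log_gapCT_div tau8v tau8v_spec.2 (by rw [gapCT_tau8v_one]; norm_num)
  rw [tau8v_eq_sigmaS8h, hM, one_div, Real.log_inv, neg_neg] at h
  refine h.congr fun n => ?_
  rw [← tau8v_eq_sigmaS8h, ← lead_pi8v_eq_gapCT, CubicalChart.lead_pi8v_eq_Q]
  push_cast
  rfl

/-- The `Q`-conjunct of `BrownZudilin2022.rates`, in its printed shape (`∃ l₃, χ(l₃) = 0 ∧ l₃ ∈ (…) ∧ log Q_n/n → log l₃`). -/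
theorem rates_Q : ∃ l₃ : ℝ, Literature.NumberTheory.Irrationality.BrownZudilin2022.charPoly l₃ = 0 ∧
    l₃ ∈ Set.Ioo ((5920793805 : ℝ) / 10 ^ 7) ((5920793806 : ℝ) / 10 ^ 7) ∧
    Filter.Tendsto (fun n : ℕ => Real.log (Literature.NumberTheory.Irrationality.BrownZudilin2022.Q n : ℝ) / n)
      Filter.atTop (nhds (Real.log l₃)) := by
  obtain ⟨lam, hmem, hχ, h⟩ := tendsto_log_Q_div
  exact ⟨lam, hχ, hmem, h⟩

end CubicalChartN

end Summit.KontsevichZagierPeriods.Zeta5Search.Families.Cellular
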